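import Literature.AlgebraicGeometry.Motives.AbelianVarietyGoodReductionTorsion
import HarnessLib

/-!
# The Tate module isomorphism packaged from compatible isomorphisms of the `ℓⁿ`-torsion
# (Serre–Tate 1968 §1 «`T_l(A) = inv lim A_{lⁿ}`»; Shimura 1998 §11.1 Prop. 14, §19.4 (19.4a))

Topic `Literature/AlgebraicGeometry/Motives`, namespace `Literature.AlgebraicGeometry.Motives.AbelianVariety`.  THEOREMS ONLY
(no definition, no named fact, no instance; net Literature debt 0).  Cell `hodgecm-mathlib` (D-0151), background programme R-pkg
(director g2 BATCH 67/68; B-p20's `SPEC-Rpkg.md`, piece **T3 «Tate packaging»**): the CONVERSE direction of §1 of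
`Motives/AbelianVarietyGoodReductionTorsion` (`torsionEquivOfTateEquiv`: from `T_ℓ A ≃ T_ℓ B` to `A[ℓⁿ] ≃ B[ℓⁿ]`).

WHAT IS HERE.  For abelian varieties `A / K` and `B / L` over possibly different fields and a prime `ℓ`, given additive
isomorphisms `e n : A[ℓⁿ](K̄) ≃ B[ℓⁿ](L̄)` for all `n`, COMPATIBLE with multiplication by `ℓ`
(`e n (ℓ x) = ℓ · e (n+1) x` for `x ∈ A[ℓⁿ⁺¹]`):
* `exists_tateModuleEquiv_of_geomTorsionEquivs` — a `ℤ_ℓ`-linear isomorphism `E : T_ℓ A ≃ T_ℓ B` with components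
  `(E a)_n = e n (a_n)` (the inverse limit of the `e n`);
* `tateModule_map_eq_of_proj_eq` — transfer of ENDOMORPHISMS: if the `e n` intertwine `f ∈ End A` with `g ∈ End B` on the
  torsion, any `E` with those components satisfies `E ∘ T_ℓ f = T_ℓ g ∘ E` (Shimura's «`M_l(λ) = M_l(λ̃)`» read upward);
* `tateModule_smul_eq_of_proj_eq` — transfer of a GALOIS ELEMENT specialising to an endomorphism: if
  `e n (σ t) = g (e n t)` on every `A[ℓⁿ]` then `E (σ a) = T_ℓ g (E a)` ((19.4a) «`(t^σ)~ = φ_𝔭(t̃)` … `𝔐_ℓ(σ) = M_ℓ(φ_𝔭)`»);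
* `tateModule_smul_eq_self_of_forall_geomTorsion` — if `σ` fixes every `A[ℓⁿ](K̄)` pointwise it fixes `T_ℓ A`
  (Serre–Tate Thm. 1, (b) ⇒ (c)).
* §3 `TateModule.map_bijective_of_injOn_surjOn` (generic abelian groups) — `T_p f` is bijective as soon as `f` is
  injective AND surjective ON EACH `pⁿ`-torsion layer (B-p20's harness slot `T3_map_bijective_of_torsionOn`; the tree's
  `TateModule.map_bijective_of_torsion` with global injectivity weakened to torsion-level), and its abelian-variety reading
  `tateModule_map_bijective_of_geomTorsion`.
Consumers: B-p20's assembly `IsAbelianSchemeModel.exists_goodReductionAt_tateSpecialisation` (fields `equiv`,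
`equiv_smul`, `equiv_tateModuleMap`, `smul_eq_self_of_mem_inertia` of `GoodReductionAt.TateSpecialisation` from the
torsion-level reduction isomorphisms T1/T2 and the torsion-level statements T4/T5/T6).

## References
* [SerreTate1968] J.-P. Serre, J. Tate, *Good reduction of abelian varieties*, Ann. of Math. 88 (1968), §1 (`T_l`, Thm. 1).
* [Shimura1998] G. Shimura, *Abelian Varieties with Complex Multiplication and Modular Functions*, Princeton 1998, §11.1
  Prop. 14 (i), §19.4 (19.4a).
* [MumfordAV1970] D. Mumford, *Abelian Varieties* (1970), §19 (the Tate module, p. 171).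
-/

set_option autoImplicit false

noncomputable section

open CategoryTheory
open scoped NumberField

namespace Literature.AlgebraicGeometry.Motives

namespace AbelianVariety

open Literature.NumberTheory.EllipticCurves (TateModule)

universe u v

variable {K : Type u} [Field K] {L : Type v} [Field L] {A : AbelianVariety K} {B : AbelianVariety L}
  {ℓ : ℕ} [Fact ℓ.Prime]

/-! ## §1. The inverse limit of compatible torsion isomorphisms -/

omit [Fact ℓ.Prime] in
/-- `ℓ · x ∈ A[ℓⁿ]` for `x ∈ A[ℓⁿ⁺¹]`. [cite: SerreTate1968, §1] -/
theorem nsmul_mem_geomTorsion_pow_of_mem_succ {n : ℕ} {x : A.geomPoints}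
    (hx : x ∈ A.geomTorsion (ℓ ^ (n + 1) : ℕ)) : ℓ • x ∈ A.geomTorsion (ℓ ^ n : ℕ) := by
  rw [AddSubgroup.torsionBy.nsmul_iff] at hx ⊢
  rw [← mul_nsmul, ← pow_succ', hx]

/-- **`T_ℓ A ≃ T_ℓ B` from compatible isomorphisms `A[ℓⁿ](K̄) ≃ B[ℓⁿ](L̄)`** (`T_l = inv lim A_{lⁿ}`): given
additive isomorphisms `e n` of the `ℓⁿ`-torsion compatible with multiplication by `ℓ`, there is a `ℤ_ℓ`-linear
isomorphism `E` of the Tate modules with components `(E a)_n = e n (a_n)`.  (`E` is unique with this property by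
`TateModule.ext`; it is built componentwise, its inverse from the `(e n)⁻¹`.)
[cite: SerreTate1968, §1 ("`T_l(A) = inv lim A_{l^n}`")] [cite: MumfordAV1970, §19 p. 171] -/
theorem exists_tateModuleEquiv_of_geomTorsionEquivs
    (e : ∀ n : ℕ, A.geomTorsion (ℓ ^ n : ℕ) ≃+ B.geomTorsion (ℓ ^ n : ℕ))
    (he : ∀ (n : ℕ) (x : A.geomTorsion (ℓ ^ (n + 1) : ℕ)) (y : A.geomTorsion (ℓ ^ n : ℕ)),
      ℓ • (x : A.geomPoints) = y → ((e n y : B.geomTorsion (ℓ ^ n : ℕ)) : B.geomPoints) =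
        ℓ • ((e (n + 1) x : B.geomTorsion (ℓ ^ (n + 1) : ℕ)) : B.geomPoints)) :
    ∃ E : A.tateModule ℓ ≃ₗ[ℤ_[ℓ]] B.tateModule ℓ,
      ∀ (n : ℕ) (a : A.tateModule ℓ),
        (B.tateModuleProjTorsion n (E a) : B.geomPoints) = e n (A.tateModuleProjTorsion n a) := by
  classical
  -- the forward map, componentwise
  let F : A.tateModule ℓ → B.tateModule ℓ := fun a =>
    TateModule.mk (fun n => (e n (A.tateModuleProjTorsion n a) : B.geomPoints))
      (fun n => AddSubgroup.torsionBy.nsmul_iff.mp (e n (A.tateModuleProjTorsion n a)).2)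
      (fun n => (he n (A.tateModuleProjTorsion (n + 1) a) (A.tateModuleProjTorsion n a)
        (TateModule.smul_proj_succ n a)).symm)
  have hF : ∀ (n : ℕ) (a : A.tateModule ℓ),
      TateModule.proj ℓ n (F a) = (e n (A.tateModuleProjTorsion n a) : B.geomPoints) := fun n a => rfl
  have hFT : ∀ (n : ℕ) (a : A.tateModule ℓ), B.tateModuleProjTorsion n (F a) = e n (A.tateModuleProjTorsion n a) :=
    fun n a => Subtype.ext (hF n a)
  -- `ℤ_ℓ`-linearity
  let Elin : A.tateModule ℓ →ₗ[ℤ_[ℓ]] B.tateModule ℓ :=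
    { toFun := F
      map_add' := fun a b => TateModule.ext fun n => by
        rw [hF, map_add, map_add, map_add, AddSubgroup.coe_add, hF, hF]
      map_smul' := fun x a => TateModule.ext fun n => by
        have h1 : A.tateModuleProjTorsion n (x • a) = (PadicInt.toZModPow n x).val • A.tateModuleProjTorsion n a :=
          Subtype.ext (by rw [coe_tateModuleProjTorsion, TateModule.proj_smul, AddSubgroupClass.coe_nsmul,
            coe_tateModuleProjTorsion])
        rw [hF, h1, map_nsmul, AddSubgroupClass.coe_nsmul, RingHom.id_apply, TateModule.proj_smul, hF] }
  -- bijectivity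
  have hinj : Function.Injective Elin := fun a b hab => by
    refine TateModule.ext fun n => ?_
    have h := congrArg (fun c => B.tateModuleProjTorsion n c) hab
    change B.tateModuleProjTorsion n (F a) = B.tateModuleProjTorsion n (F b) at h
    rw [hFT, hFT, (e n).apply_eq_iff_eq] at h
    exact congrArg Subtype.val h
  have hsurj : Function.Surjective Elin := fun b => by
    -- the compatible sequence of preimages
    let s : ℕ → A.geomPoints := fun n => ((e n).symm (B.tateModuleProjTorsion n b) : A.geomPoints)
    have hs : ∀ n, ℓ • s (n + 1) = s n := fun n => by
      have hmem := nsmul_mem_geomTorsion_pow_of_mem_succ ((e (n + 1)).symm (B.tateModuleProjTorsion (n + 1) b)).2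
      have hy : e n ⟨ℓ • s (n + 1), hmem⟩ = B.tateModuleProjTorsion n b := by
        apply Subtype.ext
        rw [he n ((e (n + 1)).symm (B.tateModuleProjTorsion (n + 1) b)) ⟨ℓ • s (n + 1), hmem⟩ rfl,
          AddEquiv.apply_symm_apply, coe_tateModuleProjTorsion, coe_tateModuleProjTorsion,
          TateModule.smul_proj_succ]
      have hy' : (⟨ℓ • s (n + 1), hmem⟩ : A.geomTorsion (ℓ ^ n : ℕ)) = (e n).symm (B.tateModuleProjTorsion n b) := by
        rw [← hy, AddEquiv.symm_apply_apply]
      exact congrArg Subtype.val hy'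
    refine ⟨TateModule.mk s (fun n => AddSubgroup.torsionBy.nsmul_iff.mp
      ((e n).symm (B.tateModuleProjTorsion n b)).2) hs, TateModule.ext fun n => ?_⟩
    change TateModule.proj ℓ n (F _) = _
    have hproj : A.tateModuleProjTorsion n (TateModule.mk s (fun n => AddSubgroup.torsionBy.nsmul_iff.mp
        ((e n).symm (B.tateModuleProjTorsion n b)).2) hs) = (e n).symm (B.tateModuleProjTorsion n b) :=
      Subtype.ext rfl
    rw [hF, hproj, AddEquiv.apply_symm_apply, coe_tateModuleProjTorsion]
  exact ⟨LinearEquiv.ofBijective Elin ⟨hinj, hsurj⟩, fun n a => hF n a⟩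

/-! ## §2. Transfer along the components -/

/-- **Transfer of endomorphisms** (Shimura Prop. 14 (i) «`M_l(λ) = M_l(λ̃)`», read from the torsion upward): if a map
`E : T_ℓ A → T_ℓ B` has components `(E a)_n = e n (a_n)` for maps `e n` on the `ℓⁿ`-torsion which intertwine
`f ∈ End A` with `g ∈ End B` (`e n (f t) = g (e n t)`), then `E (T_ℓ f a) = T_ℓ g (E a)`.
[cite: Shimura1998, §11.1 Prop. 14 (i)] [cite: SerreTate1968, §1] -/
theorem tateModule_map_eq_of_proj_eq {E : A.tateModule ℓ → B.tateModule ℓ}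
    {e : ∀ n : ℕ, A.geomTorsion (ℓ ^ n : ℕ) → B.geomTorsion (ℓ ^ n : ℕ)}
    (hE : ∀ (n : ℕ) (a : A.tateModule ℓ),
      (B.tateModuleProjTorsion n (E a) : B.geomPoints) = e n (A.tateModuleProjTorsion n a))
    {f : A ⟶ A} {g : B ⟶ B}
    (hfg : ∀ (n : ℕ) (P Q : A.geomTorsion (ℓ ^ n : ℕ)), (Q : A.geomPoints) = Hom.geomPointsMap f P →
      (e n Q : B.geomPoints) = Hom.geomPointsMap g (e n P))
    (a : A.tateModule ℓ) : E (tateModuleMap ℓ f a) = tateModuleMap ℓ g (E a) := by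
  refine TateModule.ext fun n => ?_
  have h1 : (A.tateModuleProjTorsion n (tateModuleMap ℓ f a) : A.geomPoints) =
      Hom.geomPointsMap f (A.tateModuleProjTorsion n a) := by
    rw [coe_tateModuleProjTorsion, coe_tateModuleProjTorsion, proj_tateModuleMap]
  rw [← coe_tateModuleProjTorsion, hE, hfg n _ _ h1, proj_tateModuleMap, ← coe_tateModuleProjTorsion n (E a), hE]

/-- **Transfer of a Galois element specialising to an endomorphism** (Shimura (19.4a) «`(t^σ)~ = φ_𝔭(t̃)` for every
`t ∈ 𝔤_ℓ(A)` … `𝔐_ℓ(σ) = M_ℓ(φ_𝔭)`»): if `E` has components `e n` and `e n (σ t) = g (e n t)` on every `A[ℓⁿ](K̄)`, then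
`E (σ a) = T_ℓ g (E a)` for all `a ∈ T_ℓ A`. [cite: Shimura1998, §19.4 (19.4a)] [cite: SerreTate1968, §1] -/
theorem tateModule_smul_eq_of_proj_eq {E : A.tateModule ℓ → B.tateModule ℓ}
    {e : ∀ n : ℕ, A.geomTorsion (ℓ ^ n : ℕ) → B.geomTorsion (ℓ ^ n : ℕ)}
    (hE : ∀ (n : ℕ) (a : A.tateModule ℓ),
      (B.tateModuleProjTorsion n (E a) : B.geomPoints) = e n (A.tateModuleProjTorsion n a))
    {σ : Field.absoluteGaloisGroup K} {g : B ⟶ B}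
    (hσg : ∀ (n : ℕ) (P Q : A.geomTorsion (ℓ ^ n : ℕ)), (Q : A.geomPoints) = σ • (P : A.geomPoints) →
      (e n Q : B.geomPoints) = Hom.geomPointsMap g (e n P))
    (a : A.tateModule ℓ) : E (σ • a) = tateModuleMap ℓ g (E a) := by
  refine TateModule.ext fun n => ?_
  have h1 : (A.tateModuleProjTorsion n (σ • a) : A.geomPoints) = σ • (A.tateModuleProjTorsion n a : A.geomPoints) := by
    rw [coe_tateModuleProjTorsion, coe_tateModuleProjTorsion, TateModule.proj_smul_of_distribMulAction]
  rw [← coe_tateModuleProjTorsion, hE, hσg n _ _ h1, proj_tateModuleMap, ← coe_tateModuleProjTorsion n (E a), hE]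

omit [Fact ℓ.Prime] in
/-- **Transfer of an endomorphism of `A` specialising along `E` to the Galois-twisted form** (same transfer with the
rôles of the two intertwined operations given as plain functions): if `e n (φ t) = ψ (e n t)` for additive-group
self-maps read on points, where `(φ∞ a)_n = φ (a_n)` and `(ψ∞ b)_n = ψ (b_n)`, then `E (φ∞ a) = ψ∞ (E a)`.  This is
the shape in which reduction of points commuting with a MODEL endomorphism (`F` on `𝒜`, `f` on `A`, `F_v` on `Ā`) is
consumed. [cite: Shimura1998, §11.1 Prop. 14 (i)] -/
theorem tateModule_apply_eq_of_proj_eq {E : A.tateModule ℓ → B.tateModule ℓ}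
    {e : ∀ n : ℕ, A.geomTorsion (ℓ ^ n : ℕ) → B.geomTorsion (ℓ ^ n : ℕ)}
    (hE : ∀ (n : ℕ) (a : A.tateModule ℓ),
      (B.tateModuleProjTorsion n (E a) : B.geomPoints) = e n (A.tateModuleProjTorsion n a))
    {Φ : A.tateModule ℓ → A.tateModule ℓ} {Ψ : B.tateModule ℓ → B.tateModule ℓ}
    {φ : A.geomPoints → A.geomPoints} {ψ : B.geomPoints → B.geomPoints}
    (hΦ : ∀ (n : ℕ) (a : A.tateModule ℓ), TateModule.proj ℓ n (Φ a) = φ (TateModule.proj ℓ n a))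
    (hΨ : ∀ (n : ℕ) (b : B.tateModule ℓ), TateModule.proj ℓ n (Ψ b) = ψ (TateModule.proj ℓ n b))
    (hφψ : ∀ (n : ℕ) (P Q : A.geomTorsion (ℓ ^ n : ℕ)), (Q : A.geomPoints) = φ P →
      (e n Q : B.geomPoints) = ψ (e n P))
    (a : A.tateModule ℓ) : E (Φ a) = Ψ (E a) := by
  refine TateModule.ext fun n => ?_
  have h1 : (A.tateModuleProjTorsion n (Φ a) : A.geomPoints) = φ (A.tateModuleProjTorsion n a) := by
    rw [coe_tateModuleProjTorsion, coe_tateModuleProjTorsion, hΦ]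
  rw [← coe_tateModuleProjTorsion, hE, hφψ n _ _ h1, hΨ, ← coe_tateModuleProjTorsion n (E a), hE]

omit [Fact ℓ.Prime] in
/-- **Torsion fixed pointwise ⇒ Tate module fixed** (Serre–Tate §1 Thm. 1, (b) for all `m = ℓⁿ` ⇒ (c)): if `σ` fixes
every point of every `A[ℓⁿ](K̄)` then `σ` acts trivially on `T_ℓ A`. [cite: SerreTate1968, §1 Thm. 1] -/
theorem tateModule_smul_eq_self_of_forall_geomTorsion {σ : Field.absoluteGaloisGroup K}
    (h : ∀ (n : ℕ) (P : A.geomPoints), P ∈ A.geomTorsion (ℓ ^ n : ℕ) → σ • P = P) (a : A.tateModule ℓ) :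
    σ • a = a := by
  refine TateModule.ext fun n => ?_
  rw [TateModule.proj_smul_of_distribMulAction]
  exact h n _ (TateModule.proj_mem_torsionBy n a)

/-- The same as an identity of the representation: `ρ_{A,ℓ}(σ) = 1`. [cite: SerreTate1968, §1 Thm. 1] -/
theorem tateRep_eq_one_of_forall_geomTorsion {σ : Field.absoluteGaloisGroup K}
    (h : ∀ (n : ℕ) (P : A.geomPoints), P ∈ A.geomTorsion (ℓ ^ n : ℕ) → σ • P = P) : A.tateRep ℓ σ = 1 :=
  LinearMap.ext fun a => by
    rw [tateRep_apply_apply, tateModule_smul_eq_self_of_forall_geomTorsion h]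
    rfl

end AbelianVariety

end Literature.AlgebraicGeometry.Motives

/-! ## §3. `T_p f` bijective from torsion-level injectivity and surjectivity (generic abelian groups) -/

namespace Literature.NumberTheory.EllipticCurves.TateModule

universe u v

variable {M : Type u} [AddCommGroup M] {N : Type v} [AddCommGroup N] {p : ℕ} [Fact p.Prime]

omit [Fact p.Prime] in
/-- `p · x ∈ M[pⁿ]` for `x ∈ M[pⁿ⁺¹]` (abelian groups). [cite: SerreTate1968, §1] -/
theorem nsmul_mem_torsionBy_pow_of_mem_succ {n : ℕ} {x : M}
    (hx : x ∈ AddSubgroup.torsionBy M (p ^ (n + 1) : ℕ)) : p • x ∈ AddSubgroup.torsionBy M (p ^ n : ℕ) := by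
  rw [AddSubgroup.torsionBy.nsmul_iff] at hx ⊢
  rw [← mul_nsmul, ← pow_succ', hx]

/-- **`T_p f` is bijective when `f` is injective and surjective on every `pⁿ`-torsion layer** (`T_p` is the inverse
limit of the bijections `M[pⁿ] ⥲ N[pⁿ]`): the tree's `map_bijective_of_torsion` with the global injectivity of `f`
weakened to `Set.InjOn f M[pⁿ]` — the shape in which the reduction map of an abelian-scheme model (injective on the
prime-to-`v` torsion only) is consumed. [cite: SerreTate1968, §1 ("`T_l(A) = inv lim A_{l^n}`", Lemma 2)]
[cite: SilvermanAEC2009, III.§7] -/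
theorem map_bijective_of_injOn_surjOn (f : M →+ N)
    (hinj : ∀ n : ℕ, Set.InjOn f (AddSubgroup.torsionBy M (p ^ n : ℕ) : Set M))
    (hsurj : ∀ n : ℕ, Set.SurjOn f (AddSubgroup.torsionBy M (p ^ n : ℕ) : Set M)
      (AddSubgroup.torsionBy N (p ^ n : ℕ) : Set N)) :
    Function.Bijective (map p f) := by
  classical
  refine ⟨fun a b hab => TateModule.ext fun n => ?_, fun b => ?_⟩
  · -- injective: componentwise, inside `M[pⁿ]`
    have h := congrArg (fun c => proj p n c) hab
    simp only [proj_map] at h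
    exact hinj n (proj_mem_torsionBy n a) (proj_mem_torsionBy n b) h
  · -- surjective: the compatible sequence of torsion preimages
    have hex : ∀ n : ℕ, ∃ a : M, a ∈ AddSubgroup.torsionBy M (p ^ n : ℕ) ∧ f a = proj p n b := fun n => by
      obtain ⟨a, ha, hfa⟩ := hsurj n (proj_mem_torsionBy n b)
      exact ⟨a, ha, hfa⟩
    choose g hg hfg using hex
    refine ⟨mk g (fun n => AddSubgroup.torsionBy.nsmul_iff.mp (hg n)) (fun n => ?_), TateModule.ext fun n => ?_⟩
    · -- `p · g (n+1) = g n`: both lie in `M[pⁿ]` and have the same image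
      refine hinj n (nsmul_mem_torsionBy_pow_of_mem_succ (hg (n + 1))) (hg n) ?_
      rw [map_nsmul, hfg, hfg, smul_proj_succ]
    · rw [proj_map, proj_mk, hfg]

end Literature.NumberTheory.EllipticCurves.TateModule

namespace Literature.AlgebraicGeometry.Motives.AbelianVariety

open Literature.NumberTheory.EllipticCurves (TateModule)

universe u v

/-- **Abelian-variety reading**: a homomorphism `r : A(K̄) → B(L̄)` of geometric points (e.g. the reduction map of an
abelian-scheme model) which is injective and surjective on each `A[ℓⁿ](K̄) → B[ℓⁿ](L̄)` induces a bijection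
`T_ℓ A → T_ℓ B` (`TateModule.map ℓ r`). [cite: SerreTate1968, §1 Lemma 2 and Thm. 1] -/
theorem tateModule_map_bijective_of_geomTorsion {K : Type u} [Field K] {L : Type v} [Field L]
    {A : AbelianVariety K} {B : AbelianVariety L} {ℓ : ℕ} [Fact ℓ.Prime] (r : A.geomPoints →+ B.geomPoints)
    (hinj : ∀ n : ℕ, Set.InjOn r (A.geomTorsion (ℓ ^ n : ℕ) : Set A.geomPoints))
    (hsurj : ∀ n : ℕ, Set.SurjOn r (A.geomTorsion (ℓ ^ n : ℕ) : Set A.geomPoints)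
      (B.geomTorsion (ℓ ^ n : ℕ) : Set B.geomPoints)) :
    Function.Bijective (TateModule.map ℓ r : A.tateModule ℓ → B.tateModule ℓ) :=
  TateModule.map_bijective_of_injOn_surjOn r hinj hsurj

end Literature.AlgebraicGeometry.Motives.AbelianVariety

end
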